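import Mathlib
import Summits.ResolutionOfSingularities.ResolutionOfSingularities.Theses.DefectlessFrames
import Literature.AlgebraicGeometry.Resolution.TranscendenceDefect
import Literature.AlgebraicGeometry.Resolution.Henselization
import Literature.AlgebraicGeometry.Resolution.HenselizedFunctionFields
import Summits.ResolutionOfSingularities.ResolutionOfSingularities.Theorems.DefectlessFramesDefectlessFramesRTwist
import Summits.ResolutionOfSingularities.ResolutionOfSingularities.Theorems.DefectlessFramesDefectlessFramesRSmallAxis
import Summits.ResolutionOfSingularities.ResolutionOfSingularities.Theorems.DefectlessFramesDefectlessFramesRAbhyankar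
import Summits.ResolutionOfSingularities.ResolutionOfSingularities.Theorems.DefectlessFramesDefectlessFramesRDiscrete
import Summits.ResolutionOfSingularities.ResolutionOfSingularities.Theorems.DefectlessFramesDefectlessFramesRFrameOfAxisDropAt

/-!
# Skeleton of `DefectlessFrames.DefectlessFramesR` (crux stmt-ResolutionOfSingularities-17921), line `Sketch` — v4

Lead seat prover-line-stmt-ResolutionOfSingularities-17921-c1-0 (continuation), 2026-08-17.

v2/v3 (seat 0): stubs Twist (p168731), SmallAxis (p169392), Abhyankar (p169807, tail p169596), Discrete (p169760)
landed; kernel helpers Reduction (p170041), KernelOfAxisDrop (p170215), FrameOfAxisDropAt (p170461),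
RationalUnitChart (p170774); one sorry `stub_dfrKernel` = the crux at non-Abhyankar non-discrete places for frames
of axis order `≥ p` (dossier `Cruxes/DefectlessFramesR/KERNEL.md`).

v4 (this seat): the kernel is RESHAPED into ONE strictly weaker stub `stub_dfrKernelStep` — the INDUCTIVE STEP of
Zariski's double induction at a bad place: the crux conclusion for a Twist-normalised frame (integral, separable,
general position) of axis order EXACTLY `s ≥ p`, GIVEN the crux for every frame of smaller dimension `n' < n` and for
every general-position frame of the same dimension and axis order `< s` (at every perfect ground field, function
field and rank-one zero-dimensional place). The glue `dfrStep_R` is the lexicographic strong induction on `(n, s)`: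
Twist (`stub_dfrTwist`), then axis order `< p` (`stub_dfrFrameOfAxisDropAt`), transcendence defect `0`
(`stub_dfrAbhyankar`), `O` discrete (`stub_dfrDiscrete`), else the step. Inside the step the two printed regimes are
`p ∣ s` (Cutkosky–Mourtada 2019 Thm 7.1 needs exactly the defect hypothesis the crux wants to produce) and `p ∤ s`,
`s > p` (Zariski's derivative step: one drop `s' < s` by a dominating general-position frame, then the IH) — see
KERNEL.md §2; both are engine-level, which is why the lead hands the step back as crux-sized.
-/

namespace Summit.ResolutionOfSingularities.ResolutionOfSingularities.Theorems

open Summit.ResolutionOfSingularities.ResolutionOfSingularities.Theses.DefectlessFrames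

/-- STUB (the kernel STEP; OPEN — held by the lead). At a rank-one zero-dimensional place `O ⊇ k` of positive
transcendence defect which is not discrete, an integral separable hypersurface frame `(y; z; f)` in general position
of axis order exactly `s ≥ p` satisfies the conclusion of `DefectlessFramesR`, PROVIDED the conclusion is already known
for all frames of dimension `n' < n` and for all general-position frames of dimension `n` and axis order `< s` (over
every perfect field of characteristic `p`, every function field and every rank-one zero-dimensional place). This is the
inductive step of Zariski's 1940 double induction in frame form; at `p ∣ s` it is Cutkosky–Mourtada 2019 Thm 7.1 without
its defect hypothesis (Kuhlmann's elimination of defect by re-choosing the transcendence basis inside `O`). -/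
theorem stub_dfrKernelStep : ∀ p : ℕ, p.Prime → ∀ n s : ℕ, p ≤ s → (∀ (k K : Type) [Field k] [CharP k p] [PerfectField k] [Field K] [Algebra k K], (⊤ : IntermediateField k K).FG → ∀ O : ValuationSubring K, ∀ hk : (∀ c : k, algebraMap k K c ∈ O), Nonempty O.valuation.RankOne → (∀ x ∈ O, ∃ f : Polynomial k, f ≠ 0 ∧ Polynomial.aeval x f ∈ O.nonunits) → let ρ : k →+* IsLocalRing.ResidueField O := (IsLocalRing.residue O).comp ((algebraMap k K).codRestrict O hk); let axis : (m : ℕ) → (Fin m → O) → MvPolynomial (Fin (m + 1)) k → Polynomial (IsLocalRing.ResidueField O) := fun _ w g => MvPolynomial.eval₂ (Polynomial.C.comp ρ) (Fin.snoc (fun j => Polynomial.C (IsLocalRing.residue O (w j))) Polynomial.X) g; ∀ (n' : ℕ) (y : Fin n' → O) (z : O) (f : MvPolynomial (Fin (n' + 1)) k), AlgebraicIndependent k (fun i => (y i : K)) → IntermediateField.adjoin k (Set.range (fun i => (y i : K)) ∪ {(z : K)}) = ⊤ → Ideal.span {f} = RingHom.ker (MvPolynomial.aeval (Fin.snoc (fun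 i => (y i : K)) (z : K)) : MvPolynomial (Fin (n' + 1)) k →ₐ[k] K) → f ≠ 0 → (n' < n ∨ (n' = n ∧ axis n' y f ≠ 0 ∧ (axis n' y f).rootMultiplicity (IsLocalRing.residue O z) < s)) → ∃ (y' : Fin n' → O) (z' : O) (f' : MvPolynomial (Fin (n' + 1)) k), AlgebraicIndependent k (fun i => (y' i : K)) ∧ IsIntegral (Algebra.adjoin k (Set.range fun i => (y' i : K))) (z' : K) ∧ IntermediateField.adjoin k (Set.range (fun i => (y' i : K)) ∪ {(z' : K)}) = ⊤ ∧ Ideal.span {f'} = RingHom.ker (MvPolynomial.aeval (Fin.snoc (fun i => (y' i : K)) (z' : K)) : MvPolynomial (Fin (n' + 1)) k →ₐ[k] K) ∧ (∀ i, (y i : K) ∈ Algebra.adjoin k (Set.range (fun i => (y' i : K)) ∪ {(z' : K)})) ∧ (z : K) ∈ Algebra.adjoin k (Set.range (fun i => (y' i : K)) ∪ {(z' : K)}) ∧ axis n' y' f' ≠ 0 ∧ (axis n' y f ≠ 0 → (axis n' y' f').rootMultiplicity (IsLocalRing.residue O z') ≤ (axis n' y f).rootMultiplicity (IsLocalRing.residue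 O z)) ∧ IsSeparable (IntermediateField.adjoin k (Set.range fun i => (y' i : K))) (z' : K) ∧ ∀ (Ω : Type) [Field Ω] [Algebra K Ω] [IsAlgClosure K Ω] (V : ValuationSubring Ω), V.comap (algebraMap K Ω) = O → let F : Subfield Ω := (IntermediateField.adjoin k (Set.range fun i => (y' i : K))).toSubfield.map (algebraMap K Ω); let Fh : Subfield Ω := (IntermediateField.lift (IntermediateField.fixedField (ValuationSubring.decompositionSubgroup F (V.comap (algebraMap (separableClosure F Ω) Ω))))).toSubfield; let T : Subfield Ω := Fh ⊔ (algebraMap K Ω).fieldRange; Fh ≤ T ∧ 0 < Subfield.relfinrank Fh T ∧ Subfield.relfinrank Fh T = (Literature.AlgebraicGeometry.Resolution.valueSubgroup Fh V).relIndex (Literature.AlgebraicGeometry.Resolution.valueSubgroup T V) * (Literature.AlgebraicGeometry.Resolution.residueSubfield Fh V).relfinrank (Literature.AlgebraicGeometry.Resolution.residueSubfield T V)) → ∀ (k K : Type) [Field k] [CharP k p] [PerfectField k] [Field K] [Algebra k K], (⊤ : IntermediateField k K).FG → ∀ O : ValuationSubring K, ∀ hk : (∀ c : k, algebraMap k K c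 ∈ O), Nonempty O.valuation.RankOne → (∀ x ∈ O, ∃ f : Polynomial k, f ≠ 0 ∧ Polynomial.aeval x f ∈ O.nonunits) → Literature.AlgebraicGeometry.Resolution.transcendenceDefect k O hk ≠ 0 → ¬ IsDiscreteValuationRing O → let ρ : k →+* IsLocalRing.ResidueField O := (IsLocalRing.residue O).comp ((algebraMap k K).codRestrict O hk); let axis : (m : ℕ) → (Fin m → O) → MvPolynomial (Fin (m + 1)) k → Polynomial (IsLocalRing.ResidueField O) := fun _ w g => MvPolynomial.eval₂ (Polynomial.C.comp ρ) (Fin.snoc (fun j => Polynomial.C (IsLocalRing.residue O (w j))) Polynomial.X) g; ∀ (y : Fin n → O) (z : O) (f : MvPolynomial (Fin (n + 1)) k), AlgebraicIndependent k (fun i => (y i : K)) → IsIntegral (Algebra.adjoin k (Set.range fun i => (y i : K))) (z : K) → IntermediateField.adjoin k (Set.range (fun i => (y i : K)) ∪ {(z : K)}) = ⊤ → Ideal.span {f} = RingHom.ker (MvPolynomial.aeval (Fin.snoc (fun i => (y i : K)) (z : K)) : MvPolynomial (Fin (n + 1)) k →ₐ[k] K) → axis n y f ≠ 0 → (axis n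 y f).rootMultiplicity (IsLocalRing.residue O z) = s → IsSeparable (IntermediateField.adjoin k (Set.range fun i => (y i : K))) (z : K) → ∃ (y' : Fin n → O) (z' : O) (f' : MvPolynomial (Fin (n + 1)) k), AlgebraicIndependent k (fun i => (y' i : K)) ∧ IsIntegral (Algebra.adjoin k (Set.range fun i => (y' i : K))) (z' : K) ∧ IntermediateField.adjoin k (Set.range (fun i => (y' i : K)) ∪ {(z' : K)}) = ⊤ ∧ Ideal.span {f'} = RingHom.ker (MvPolynomial.aeval (Fin.snoc (fun i => (y' i : K)) (z' : K)) : MvPolynomial (Fin (n + 1)) k →ₐ[k] K) ∧ (∀ i, (y i : K) ∈ Algebra.adjoin k (Set.range (fun i => (y' i : K)) ∪ {(z' : K)})) ∧ (z : K) ∈ Algebra.adjoin k (Set.range (fun i => (y' i : K)) ∪ {(z' : K)}) ∧ axis n y' f' ≠ 0 ∧ (axis n y f ≠ 0 → (axis n y' f').rootMultiplicity (IsLocalRing.residue O z') ≤ (axis n y f).rootMultiplicity (IsLocalRing.residue O z)) ∧ IsSeparable (IntermediateField.adjoin k (Set.range fun i => (y' i : K))) (z' : K) ∧ ∀ (Ω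 : Type) [Field Ω] [Algebra K Ω] [IsAlgClosure K Ω] (V : ValuationSubring Ω), V.comap (algebraMap K Ω) = O → let F : Subfield Ω := (IntermediateField.adjoin k (Set.range fun i => (y' i : K))).toSubfield.map (algebraMap K Ω); let Fh : Subfield Ω := (IntermediateField.lift (IntermediateField.fixedField (ValuationSubring.decompositionSubgroup F (V.comap (algebraMap (separableClosure F Ω) Ω))))).toSubfield; let T : Subfield Ω := Fh ⊔ (algebraMap K Ω).fieldRange; Fh ≤ T ∧ 0 < Subfield.relfinrank Fh T ∧ Subfield.relfinrank Fh T = (Literature.AlgebraicGeometry.Resolution.valueSubgroup Fh V).relIndex (Literature.AlgebraicGeometry.Resolution.valueSubgroup T V) * (Literature.AlgebraicGeometry.Resolution.residueSubfield Fh V).relfinrank (Literature.AlgebraicGeometry.Resolution.residueSubfield T V) := by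
  sorry

/-- Transfer of the conclusion of `DefectlessFramesR` along domination: if `(y₁; z₁; f₁)` is a general-position frame
dominating `(y; z; f)` with axis order not larger (when `(y; z; f)` is in general position), then the conclusion for
`(y₁; z₁; f₁)` implies the conclusion for `(y; z; f)` (domination and the axis bound compose). [folklore] -/
theorem dfrStep_transfer : ∀ (k K : Type) [Field k] [Field K] [Algebra k K], ∀ O : ValuationSubring K, ∀ hk : (∀ c : k, algebraMap k K c ∈ O), let ρ : k →+* IsLocalRing.ResidueField O := (IsLocalRing.residue O).comp ((algebraMap k K).codRestrict O hk); let axis : (m : ℕ) → (Fin m → O) → MvPolynomial (Fin (m + 1)) k → Polynomial (IsLocalRing.ResidueField O) := fun _ w g => MvPolynomial.eval₂ (Polynomial.C.comp ρ) (Fin.snoc (fun j => Polynomial.C (IsLocalRing.residue O (w j))) Polynomial.X) g; ∀ (n : ℕ) (y : Fin n → O) (z : O) (f : MvPolynomial (Fin (n + 1)) k) (y₁ : Fin n → O) (z₁ : O) (f₁ : MvPolynomial (Fin (n + 1)) k), (∀ i, (y i : K) ∈ Algebra.adjoin k (Set.range (fun i => (y₁ i : K)) ∪ {(z₁ : K)}))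 → (z : K) ∈ Algebra.adjoin k (Set.range (fun i => (y₁ i : K)) ∪ {(z₁ : K)}) → axis n y₁ f₁ ≠ 0 → (axis n y f ≠ 0 → (axis n y₁ f₁).rootMultiplicity (IsLocalRing.residue O z₁) ≤ (axis n y f).rootMultiplicity (IsLocalRing.residue O z)) → (∃ (y' : Fin n → O) (z' : O) (f' : MvPolynomial (Fin (n + 1)) k), AlgebraicIndependent k (fun i => (y' i : K)) ∧ IsIntegral (Algebra.adjoin k (Set.range fun i => (y' i : K))) (z' : K) ∧ IntermediateField.adjoin k (Set.range (fun i => (y' i : K)) ∪ {(z' : K)}) = ⊤ ∧ Ideal.span {f'} = RingHom.ker (MvPolynomial.aeval (Fin.snoc (fun i => (y' i : K)) (z' : K)) : MvPolynomial (Fin (n + 1)) k →ₐ[k] K) ∧ (∀ i, (y₁ i : K) ∈ Algebra.adjoin k (Set.range (fun i => (y' i : K)) ∪ {(z' : K)})) ∧ (z₁ : K) ∈ Algebra.adjoin k (Set.range (fun i => (y' i : K)) ∪ {(z' : K)}) ∧ axis n y' f' ≠ 0 ∧ (axis n y₁ f₁ ≠ 0 → (axis n y' f').rootMultiplicity (IsLocalRing.residue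 O z') ≤ (axis n y₁ f₁).rootMultiplicity (IsLocalRing.residue O z₁)) ∧ IsSeparable (IntermediateField.adjoin k (Set.range fun i => (y' i : K))) (z' : K) ∧ ∀ (Ω : Type) [Field Ω] [Algebra K Ω] [IsAlgClosure K Ω] (V : ValuationSubring Ω), V.comap (algebraMap K Ω) = O → let F : Subfield Ω := (IntermediateField.adjoin k (Set.range fun i => (y' i : K))).toSubfield.map (algebraMap K Ω); let Fh : Subfield Ω := (IntermediateField.lift (IntermediateField.fixedField (ValuationSubring.decompositionSubgroup F (V.comap (algebraMap (separableClosure F Ω) Ω))))).toSubfield; let T : Subfield Ω := Fh ⊔ (algebraMap K Ω).fieldRange; Fh ≤ T ∧ 0 < Subfield.relfinrank Fh T ∧ Subfield.relfinrank Fh T = (Literature.AlgebraicGeometry.Resolution.valueSubgroup Fh V).relIndex (Literature.AlgebraicGeometry.Resolution.valueSubgroup T V) * (Literature.AlgebraicGeometry.Resolution.residueSubfield Fh V).relfinrank (Literature.AlgebraicGeometry.Resolution.residueSubfield T V)) → ∃ (y' : Fin n → O) (z' : O) (f' : MvPolynomial (Fin (n + 1)) k), AlgebraicIndependent k (fun i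 => (y' i : K)) ∧ IsIntegral (Algebra.adjoin k (Set.range fun i => (y' i : K))) (z' : K) ∧ IntermediateField.adjoin k (Set.range (fun i => (y' i : K)) ∪ {(z' : K)}) = ⊤ ∧ Ideal.span {f'} = RingHom.ker (MvPolynomial.aeval (Fin.snoc (fun i => (y' i : K)) (z' : K)) : MvPolynomial (Fin (n + 1)) k →ₐ[k] K) ∧ (∀ i, (y i : K) ∈ Algebra.adjoin k (Set.range (fun i => (y' i : K)) ∪ {(z' : K)})) ∧ (z : K) ∈ Algebra.adjoin k (Set.range (fun i => (y' i : K)) ∪ {(z' : K)}) ∧ axis n y' f' ≠ 0 ∧ (axis n y f ≠ 0 → (axis n y' f').rootMultiplicity (IsLocalRing.residue O z') ≤ (axis n y f).rootMultiplicity (IsLocalRing.residue O z)) ∧ IsSeparable (IntermediateField.adjoin k (Set.range fun i => (y' i : K))) (z' : K) ∧ ∀ (Ω : Type) [Field Ω] [Algebra K Ω] [IsAlgClosure K Ω] (V : ValuationSubring Ω), V.comap (algebraMap K Ω) = O → let F : Subfield Ω := (IntermediateField.adjoin k (Set.range fun i => (y' i : K))).toSubfield.map (algebraMap K Ω); let Fh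 : Subfield Ω := (IntermediateField.lift (IntermediateField.fixedField (ValuationSubring.decompositionSubgroup F (V.comap (algebraMap (separableClosure F Ω) Ω))))).toSubfield; let T : Subfield Ω := Fh ⊔ (algebraMap K Ω).fieldRange; Fh ≤ T ∧ 0 < Subfield.relfinrank Fh T ∧ Subfield.relfinrank Fh T = (Literature.AlgebraicGeometry.Resolution.valueSubgroup Fh V).relIndex (Literature.AlgebraicGeometry.Resolution.valueSubgroup T V) * (Literature.AlgebraicGeometry.Resolution.residueSubfield Fh V).relfinrank (Literature.AlgebraicGeometry.Resolution.residueSubfield T V) := by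
  intro k K _ _ _ O hk ρ axis n y z f y₁ z₁ f₁ hdomy hdomz hax₁ hle hcon
  obtain ⟨y', z', f', c1, c2, c3, c4, c5, c6, c7, c8, c9, c10⟩ := hcon
  have hsub : Algebra.adjoin k (Set.range (fun i => (y₁ i : K)) ∪ {(z₁ : K)}) ≤
      Algebra.adjoin k (Set.range (fun i => (y' i : K)) ∪ {(z' : K)}) := by
    refine Algebra.adjoin_le ?_
    rintro x (⟨i, rfl⟩ | hx)
    · exact c5 i
    · rw [Set.mem_singleton_iff] at hx
      rw [hx]
      exact c6
  exact ⟨y', z', f', c1, c2, c3, c4, fun i => hsub (hdomy i), hsub hdomz, c7,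
    fun hax => (c8 hax₁).trans (hle hax), c9, c10⟩

/-- GLUE, the double induction: for every prime `p`, dimension `n` and axis order `s`, every general-position frame of
dimension `n` and axis order exactly `s` over a rank-one zero-dimensional place of a function field over a perfect field
of characteristic `p` satisfies the conclusion of `DefectlessFramesR` — by lexicographic strong induction on `(n, s)` from
`stub_dfrTwist`, `stub_dfrFrameOfAxisDropAt` (`s < p`), `stub_dfrAbhyankar`, `stub_dfrDiscrete` and the step. -/
theorem dfrStep_R (hK : ∀ p : ℕ, p.Prime → ∀ n s : ℕ, p ≤ s → (∀ (k K : Type) [Field k] [CharP k p] [PerfectField k] [Field K] [Algebra k K], (⊤ : IntermediateField k K).FG → ∀ O : ValuationSubring K, ∀ hk : (∀ c : k, algebraMap k K c ∈ O), Nonempty O.valuation.RankOne → (∀ x ∈ O, ∃ f : Polynomial k, f ≠ 0 ∧ Polynomial.aeval x f ∈ O.nonunits) → let ρ : k →+* IsLocalRing.ResidueField O := (IsLocalRing.residue O).comp ((algebraMap k K).codRestrict O hk); let axis : (m : ℕ) → (Fin m → O) → MvPolynomial (Fin (m + 1)) k → Polynomial (IsLocalRing.ResidueField O) := fun _ w g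 => MvPolynomial.eval₂ (Polynomial.C.comp ρ) (Fin.snoc (fun j => Polynomial.C (IsLocalRing.residue O (w j))) Polynomial.X) g; ∀ (n' : ℕ) (y : Fin n' → O) (z : O) (f : MvPolynomial (Fin (n' + 1)) k), AlgebraicIndependent k (fun i => (y i : K)) → IntermediateField.adjoin k (Set.range (fun i => (y i : K)) ∪ {(z : K)}) = ⊤ → Ideal.span {f} = RingHom.ker (MvPolynomial.aeval (Fin.snoc (fun i => (y i : K)) (z : K)) : MvPolynomial (Fin (n' + 1)) k →ₐ[k] K) → f ≠ 0 → (n' < n ∨ (n' = n ∧ axis n' y f ≠ 0 ∧ (axis n' y f).rootMultiplicity (IsLocalRing.residue O z) < s)) → ∃ (y' : Fin n' → O) (z' : O) (f' : MvPolynomial (Fin (n' + 1)) k), AlgebraicIndependent k (fun i => (y' i : K)) ∧ IsIntegral (Algebra.adjoin k (Set.range fun i => (y' i : K))) (z' : K) ∧ IntermediateField.adjoin k (Set.range (fun i => (y' i : K)) ∪ {(z' : K)}) = ⊤ ∧ Ideal.span {f'} = RingHom.ker (MvPolynomial.aeval (Fin.snoc (fun i => (y' i : K)) (z' : K)) : MvPolynomial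 (Fin (n' + 1)) k →ₐ[k] K) ∧ (∀ i, (y i : K) ∈ Algebra.adjoin k (Set.range (fun i => (y' i : K)) ∪ {(z' : K)})) ∧ (z : K) ∈ Algebra.adjoin k (Set.range (fun i => (y' i : K)) ∪ {(z' : K)}) ∧ axis n' y' f' ≠ 0 ∧ (axis n' y f ≠ 0 → (axis n' y' f').rootMultiplicity (IsLocalRing.residue O z') ≤ (axis n' y f).rootMultiplicity (IsLocalRing.residue O z)) ∧ IsSeparable (IntermediateField.adjoin k (Set.range fun i => (y' i : K))) (z' : K) ∧ ∀ (Ω : Type) [Field Ω] [Algebra K Ω] [IsAlgClosure K Ω] (V : ValuationSubring Ω), V.comap (algebraMap K Ω) = O → let F : Subfield Ω := (IntermediateField.adjoin k (Set.range fun i => (y' i : K))).toSubfield.map (algebraMap K Ω); let Fh : Subfield Ω := (IntermediateField.lift (IntermediateField.fixedField (ValuationSubring.decompositionSubgroup F (V.comap (algebraMap (separableClosure F Ω) Ω))))).toSubfield; let T : Subfield Ω := Fh ⊔ (algebraMap K Ω).fieldRange; Fh ≤ T ∧ 0 < Subfield.relfinrank Fh T ∧ Subfield.relfinrank Fh T =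 (Literature.AlgebraicGeometry.Resolution.valueSubgroup Fh V).relIndex (Literature.AlgebraicGeometry.Resolution.valueSubgroup T V) * (Literature.AlgebraicGeometry.Resolution.residueSubfield Fh V).relfinrank (Literature.AlgebraicGeometry.Resolution.residueSubfield T V)) → ∀ (k K : Type) [Field k] [CharP k p] [PerfectField k] [Field K] [Algebra k K], (⊤ : IntermediateField k K).FG → ∀ O : ValuationSubring K, ∀ hk : (∀ c : k, algebraMap k K c ∈ O), Nonempty O.valuation.RankOne → (∀ x ∈ O, ∃ f : Polynomial k, f ≠ 0 ∧ Polynomial.aeval x f ∈ O.nonunits) → Literature.AlgebraicGeometry.Resolution.transcendenceDefect k O hk ≠ 0 → ¬ IsDiscreteValuationRing O → let ρ : k →+* IsLocalRing.ResidueField O := (IsLocalRing.residue O).comp ((algebraMap k K).codRestrict O hk); let axis : (m : ℕ) → (Fin m → O) → MvPolynomial (Fin (m + 1)) k → Polynomial (IsLocalRing.ResidueField O) := fun _ w g => MvPolynomial.eval₂ (Polynomial.C.comp ρ) (Fin.snoc (fun j => Polynomial.C (IsLocalRing.residue O (w j))) Polynomial.X) g; ∀ (y : Fin n → O) (z : O)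 (f : MvPolynomial (Fin (n + 1)) k), AlgebraicIndependent k (fun i => (y i : K)) → IsIntegral (Algebra.adjoin k (Set.range fun i => (y i : K))) (z : K) → IntermediateField.adjoin k (Set.range (fun i => (y i : K)) ∪ {(z : K)}) = ⊤ → Ideal.span {f} = RingHom.ker (MvPolynomial.aeval (Fin.snoc (fun i => (y i : K)) (z : K)) : MvPolynomial (Fin (n + 1)) k →ₐ[k] K) → axis n y f ≠ 0 → (axis n y f).rootMultiplicity (IsLocalRing.residue O z) = s → IsSeparable (IntermediateField.adjoin k (Set.range fun i => (y i : K))) (z : K) → ∃ (y' : Fin n → O) (z' : O) (f' : MvPolynomial (Fin (n + 1)) k), AlgebraicIndependent k (fun i => (y' i : K)) ∧ IsIntegral (Algebra.adjoin k (Set.range fun i => (y' i : K))) (z' : K) ∧ IntermediateField.adjoin k (Set.range (fun i => (y' i : K)) ∪ {(z' : K)}) = ⊤ ∧ Ideal.span {f'} = RingHom.ker (MvPolynomial.aeval (Fin.snoc (fun i => (y' i : K)) (z' : K)) : MvPolynomial (Fin (n + 1)) k →ₐ[k] K) ∧ (∀ i, (y i : K) ∈ Algebra.adjoin k (Set.range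 (fun i => (y' i : K)) ∪ {(z' : K)})) ∧ (z : K) ∈ Algebra.adjoin k (Set.range (fun i => (y' i : K)) ∪ {(z' : K)}) ∧ axis n y' f' ≠ 0 ∧ (axis n y f ≠ 0 → (axis n y' f').rootMultiplicity (IsLocalRing.residue O z') ≤ (axis n y f).rootMultiplicity (IsLocalRing.residue O z)) ∧ IsSeparable (IntermediateField.adjoin k (Set.range fun i => (y' i : K))) (z' : K) ∧ ∀ (Ω : Type) [Field Ω] [Algebra K Ω] [IsAlgClosure K Ω] (V : ValuationSubring Ω), V.comap (algebraMap K Ω) = O → let F : Subfield Ω := (IntermediateField.adjoin k (Set.range fun i => (y' i : K))).toSubfield.map (algebraMap K Ω); let Fh : Subfield Ω := (IntermediateField.lift (IntermediateField.fixedField (ValuationSubring.decompositionSubgroup F (V.comap (algebraMap (separableClosure F Ω) Ω))))).toSubfield; let T : Subfield Ω := Fh ⊔ (algebraMap K Ω).fieldRange; Fh ≤ T ∧ 0 < Subfield.relfinrank Fh T ∧ Subfield.relfinrank Fh T = (Literature.AlgebraicGeometry.Resolution.valueSubgroup Fh V).relIndex (Literature.AlgebraicGeometry.Resolution.valueSubgroup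 T V) * (Literature.AlgebraicGeometry.Resolution.residueSubfield Fh V).relfinrank (Literature.AlgebraicGeometry.Resolution.residueSubfield T V)) : ∀ p : ℕ, p.Prime → ∀ n s : ℕ, ∀ (k K : Type) [Field k] [CharP k p] [PerfectField k] [Field K] [Algebra k K], (⊤ : IntermediateField k K).FG → ∀ O : ValuationSubring K, ∀ hk : (∀ c : k, algebraMap k K c ∈ O), Nonempty O.valuation.RankOne → (∀ x ∈ O, ∃ f : Polynomial k, f ≠ 0 ∧ Polynomial.aeval x f ∈ O.nonunits) → let ρ : k →+* IsLocalRing.ResidueField O := (IsLocalRing.residue O).comp ((algebraMap k K).codRestrict O hk); let axis : (m : ℕ) → (Fin m → O) → MvPolynomial (Fin (m + 1)) k → Polynomial (IsLocalRing.ResidueField O) := fun _ w g => MvPolynomial.eval₂ (Polynomial.C.comp ρ) (Fin.snoc (fun j => Polynomial.C (IsLocalRing.residue O (w j))) Polynomial.X) g; ∀ (y : Fin n → O) (z : O) (f : MvPolynomial (Fin (n + 1)) k), AlgebraicIndependent k (fun i => (y i : K)) → IntermediateField.adjoin k (Set.range (fun i => (y i : K)) ∪ {(z : K)}) = ⊤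 → Ideal.span {f} = RingHom.ker (MvPolynomial.aeval (Fin.snoc (fun i => (y i : K)) (z : K)) : MvPolynomial (Fin (n + 1)) k →ₐ[k] K) → f ≠ 0 → axis n y f ≠ 0 → (axis n y f).rootMultiplicity (IsLocalRing.residue O z) = s → ∃ (y' : Fin n → O) (z' : O) (f' : MvPolynomial (Fin (n + 1)) k), AlgebraicIndependent k (fun i => (y' i : K)) ∧ IsIntegral (Algebra.adjoin k (Set.range fun i => (y' i : K))) (z' : K) ∧ IntermediateField.adjoin k (Set.range (fun i => (y' i : K)) ∪ {(z' : K)}) = ⊤ ∧ Ideal.span {f'} = RingHom.ker (MvPolynomial.aeval (Fin.snoc (fun i => (y' i : K)) (z' : K)) : MvPolynomial (Fin (n + 1)) k →ₐ[k] K) ∧ (∀ i, (y i : K) ∈ Algebra.adjoin k (Set.range (fun i => (y' i : K)) ∪ {(z' : K)})) ∧ (z : K) ∈ Algebra.adjoin k (Set.range (fun i => (y' i : K)) ∪ {(z' : K)}) ∧ axis n y' f' ≠ 0 ∧ (axis n y f ≠ 0 → (axis n y' f').rootMultiplicity (IsLocalRing.residue O z') ≤ (axis n y f).rootMultiplicity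 (IsLocalRing.residue O z)) ∧ IsSeparable (IntermediateField.adjoin k (Set.range fun i => (y' i : K))) (z' : K) ∧ ∀ (Ω : Type) [Field Ω] [Algebra K Ω] [IsAlgClosure K Ω] (V : ValuationSubring Ω), V.comap (algebraMap K Ω) = O → let F : Subfield Ω := (IntermediateField.adjoin k (Set.range fun i => (y' i : K))).toSubfield.map (algebraMap K Ω); let Fh : Subfield Ω := (IntermediateField.lift (IntermediateField.fixedField (ValuationSubring.decompositionSubgroup F (V.comap (algebraMap (separableClosure F Ω) Ω))))).toSubfield; let T : Subfield Ω := Fh ⊔ (algebraMap K Ω).fieldRange; Fh ≤ T ∧ 0 < Subfield.relfinrank Fh T ∧ Subfield.relfinrank Fh T = (Literature.AlgebraicGeometry.Resolution.valueSubgroup Fh V).relIndex (Literature.AlgebraicGeometry.Resolution.valueSubgroup T V) * (Literature.AlgebraicGeometry.Resolution.residueSubfield Fh V).relfinrank (Literature.AlgebraicGeometry.Resolution.residueSubfield T V) := by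
  intro p hp n
  induction n using Nat.strong_induction_on with
  | _ n ihn =>
  intro s
  induction s using Nat.strong_induction_on with
  | _ s ihs =>
  intro k K _ _ _ _ _ hfg O hk hR hZ ρ axis y z f hy hadj hker hf hax hs
  -- normalise the frame (integral, separable, general position, axis order not increased)
  obtain ⟨y₁, z₁, f₁, h1, h2, h3, h4, h5, h6, h7, h8, h9⟩ :=
    stub_dfrTwist p hp k K hfg O hk hR hZ n y z f hy hadj hker hf
  have hf₁ : f₁ ≠ 0 := by
    rintro rfl
    exact h7 (MvPolynomial.eval₂_zero _ _)
  have h8' : (axis n y₁ f₁).rootMultiplicity (IsLocalRing.residue O z₁) ≤ s := hs ▸ h8 hax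
  rcases h8'.lt_or_eq with hlt | heq
  · -- the axis order dropped: induction hypothesis in the same dimension
    exact dfrStep_transfer k K O hk n y z f y₁ z₁ f₁ h5 h6 h7 h8
      (ihs _ hlt k K hfg O hk hR hZ y₁ z₁ f₁ h1 h3 h4 hf₁ h7 rfl)
  by_cases hsp : s < p
  · -- axis order below `p`: Hensel cluster budget + Ostrowski
    exact stub_dfrFrameOfAxisDropAt p hp k K hfg O hk hR hZ n y z f hy hadj hker hf
      ⟨y₁, z₁, f₁, h1, h3, h4, hf₁, h5, h6, h7, heq ▸ hsp, h8⟩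
  by_cases habh : Literature.AlgebraicGeometry.Resolution.transcendenceDefect k O hk = 0
  · -- Abhyankar place: generalized stability
    exact ⟨y₁, z₁, f₁, h1, h2, h3, h4, h5, h6, h7, h8, h9, fun Ω _ _ _ V hV =>
      stub_dfrAbhyankar p hp k K hfg O hk hR hZ habh n y₁ z₁ h1 h2 h3 h9 Ω V hV⟩
  by_cases hdisc : IsDiscreteValuationRing O
  · -- discrete rank-one place: henselian DVF separably defectless
    exact ⟨y₁, z₁, f₁, h1, h2, h3, h4, h5, h6, h7, h8, h9, fun Ω _ _ _ V hV =>
      stub_dfrDiscrete p hp k K hfg O hk hR hZ hdisc n y₁ z₁ h1 h2 h3 h9 Ω V hV⟩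
  -- the bad place: the inductive step, fed with the lexicographic induction hypothesis
  refine dfrStep_transfer k K O hk n y z f y₁ z₁ f₁ h5 h6 h7 h8
    (hK p hp n s (not_lt.mp hsp) ?_ k K hfg O hk hR hZ habh hdisc y₁ z₁ f₁ h1 h2 h3 h4 h7 heq h9)
  intro k' K' _ _ _ _ _ hfg' O' hk' hR' hZ' ρ' axis' n' y₀ z₀ f₀ hy₀ hadj₀ hker₀ hf₀ hcase
  rcases hcase with hlt | ⟨rfl, hax₀, hlt⟩
  · -- smaller dimension: normalise, then the outer induction hypothesis at the new axis order
    obtain ⟨y₂, z₂, f₂, g1, g2, g3, g4, g5, g6, g7, g8, g9⟩ :=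
      stub_dfrTwist p hp k' K' hfg' O' hk' hR' hZ' n' y₀ z₀ f₀ hy₀ hadj₀ hker₀ hf₀
    have hf₂ : f₂ ≠ 0 := by
      rintro rfl
      exact g7 (MvPolynomial.eval₂_zero _ _)
    exact dfrStep_transfer k' K' O' hk' n' y₀ z₀ f₀ y₂ z₂ f₂ g5 g6 g7 g8
      (ihn n' hlt _ k' K' hfg' O' hk' hR' hZ' y₂ z₂ f₂ g1 g3 g4 hf₂ g7 rfl)
  · -- same dimension, smaller axis order: the inner induction hypothesis
    exact ihs _ hlt k' K' hfg' O' hk' hR' hZ' y₀ z₀ f₀ hy₀ hadj₀ hker₀ hf₀ hax₀ rfl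

/-- GLUE: the crux from the double induction (`dfrStep_R`): normalise the given frame by `stub_dfrTwist` and transfer
the conclusion of the general-position frame so obtained. -/
theorem defectlessFramesR_of_kernelStep (hK : ∀ p : ℕ, p.Prime → ∀ n s : ℕ, p ≤ s → (∀ (k K : Type) [Field k] [CharP k p] [PerfectField k] [Field K] [Algebra k K], (⊤ : IntermediateField k K).FG → ∀ O : ValuationSubring K, ∀ hk : (∀ c : k, algebraMap k K c ∈ O), Nonempty O.valuation.RankOne → (∀ x ∈ O, ∃ f : Polynomial k, f ≠ 0 ∧ Polynomial.aeval x f ∈ O.nonunits) → let ρ : k →+* IsLocalRing.ResidueField O := (IsLocalRing.residue O).comp ((algebraMap k K).codRestrict O hk); let axis : (m : ℕ) → (Fin m → O) → MvPolynomial (Fin (m + 1)) k → Polynomial (IsLocalRing.ResidueField O) := fun _ w g => MvPolynomial.eval₂ (Polynomial.C.comp ρ) (Fin.snoc (fun j => Polynomial.C (IsLocalRing.residue O (w j))) Polynomial.X) g; ∀ (n' : ℕ) (y : Fin n' → O) (z : O) (f : MvPolynomial (Fin (n' + 1)) k), AlgebraicIndependent k (fun i => (y i : K)) → IntermediateField.adjoin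 k (Set.range (fun i => (y i : K)) ∪ {(z : K)}) = ⊤ → Ideal.span {f} = RingHom.ker (MvPolynomial.aeval (Fin.snoc (fun i => (y i : K)) (z : K)) : MvPolynomial (Fin (n' + 1)) k →ₐ[k] K) → f ≠ 0 → (n' < n ∨ (n' = n ∧ axis n' y f ≠ 0 ∧ (axis n' y f).rootMultiplicity (IsLocalRing.residue O z) < s)) → ∃ (y' : Fin n' → O) (z' : O) (f' : MvPolynomial (Fin (n' + 1)) k), AlgebraicIndependent k (fun i => (y' i : K)) ∧ IsIntegral (Algebra.adjoin k (Set.range fun i => (y' i : K))) (z' : K) ∧ IntermediateField.adjoin k (Set.range (fun i => (y' i : K)) ∪ {(z' : K)}) = ⊤ ∧ Ideal.span {f'} = RingHom.ker (MvPolynomial.aeval (Fin.snoc (fun i => (y' i : K)) (z' : K)) : MvPolynomial (Fin (n' + 1)) k →ₐ[k] K) ∧ (∀ i, (y i : K) ∈ Algebra.adjoin k (Set.range (fun i => (y' i : K)) ∪ {(z' : K)})) ∧ (z : K) ∈ Algebra.adjoin k (Set.range (fun i => (y' i : K)) ∪ {(z' : K)}) ∧ axis n' y' f' ≠ 0 ∧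 (axis n' y f ≠ 0 → (axis n' y' f').rootMultiplicity (IsLocalRing.residue O z') ≤ (axis n' y f).rootMultiplicity (IsLocalRing.residue O z)) ∧ IsSeparable (IntermediateField.adjoin k (Set.range fun i => (y' i : K))) (z' : K) ∧ ∀ (Ω : Type) [Field Ω] [Algebra K Ω] [IsAlgClosure K Ω] (V : ValuationSubring Ω), V.comap (algebraMap K Ω) = O → let F : Subfield Ω := (IntermediateField.adjoin k (Set.range fun i => (y' i : K))).toSubfield.map (algebraMap K Ω); let Fh : Subfield Ω := (IntermediateField.lift (IntermediateField.fixedField (ValuationSubring.decompositionSubgroup F (V.comap (algebraMap (separableClosure F Ω) Ω))))).toSubfield; let T : Subfield Ω := Fh ⊔ (algebraMap K Ω).fieldRange; Fh ≤ T ∧ 0 < Subfield.relfinrank Fh T ∧ Subfield.relfinrank Fh T = (Literature.AlgebraicGeometry.Resolution.valueSubgroup Fh V).relIndex (Literature.AlgebraicGeometry.Resolution.valueSubgroup T V) * (Literature.AlgebraicGeometry.Resolution.residueSubfield Fh V).relfinrank (Literature.AlgebraicGeometry.Resolution.residueSubfield T V)) → ∀ (k K : Type) [Field k] [CharP k p]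 [PerfectField k] [Field K] [Algebra k K], (⊤ : IntermediateField k K).FG → ∀ O : ValuationSubring K, ∀ hk : (∀ c : k, algebraMap k K c ∈ O), Nonempty O.valuation.RankOne → (∀ x ∈ O, ∃ f : Polynomial k, f ≠ 0 ∧ Polynomial.aeval x f ∈ O.nonunits) → Literature.AlgebraicGeometry.Resolution.transcendenceDefect k O hk ≠ 0 → ¬ IsDiscreteValuationRing O → let ρ : k →+* IsLocalRing.ResidueField O := (IsLocalRing.residue O).comp ((algebraMap k K).codRestrict O hk); let axis : (m : ℕ) → (Fin m → O) → MvPolynomial (Fin (m + 1)) k → Polynomial (IsLocalRing.ResidueField O) := fun _ w g => MvPolynomial.eval₂ (Polynomial.C.comp ρ) (Fin.snoc (fun j => Polynomial.C (IsLocalRing.residue O (w j))) Polynomial.X) g; ∀ (y : Fin n → O) (z : O) (f : MvPolynomial (Fin (n + 1)) k), AlgebraicIndependent k (fun i => (y i : K)) → IsIntegral (Algebra.adjoin k (Set.range fun i => (y i : K))) (z : K) → IntermediateField.adjoin k (Set.range (fun i => (y i : K)) ∪ {(z : K)}) = ⊤ → Ideal.span {f} = RingHom.ker (MvPolynomial.aeval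 (Fin.snoc (fun i => (y i : K)) (z : K)) : MvPolynomial (Fin (n + 1)) k →ₐ[k] K) → axis n y f ≠ 0 → (axis n y f).rootMultiplicity (IsLocalRing.residue O z) = s → IsSeparable (IntermediateField.adjoin k (Set.range fun i => (y i : K))) (z : K) → ∃ (y' : Fin n → O) (z' : O) (f' : MvPolynomial (Fin (n + 1)) k), AlgebraicIndependent k (fun i => (y' i : K)) ∧ IsIntegral (Algebra.adjoin k (Set.range fun i => (y' i : K))) (z' : K) ∧ IntermediateField.adjoin k (Set.range (fun i => (y' i : K)) ∪ {(z' : K)}) = ⊤ ∧ Ideal.span {f'} = RingHom.ker (MvPolynomial.aeval (Fin.snoc (fun i => (y' i : K)) (z' : K)) : MvPolynomial (Fin (n + 1)) k →ₐ[k] K) ∧ (∀ i, (y i : K) ∈ Algebra.adjoin k (Set.range (fun i => (y' i : K)) ∪ {(z' : K)})) ∧ (z : K) ∈ Algebra.adjoin k (Set.range (fun i => (y' i : K)) ∪ {(z' : K)}) ∧ axis n y' f' ≠ 0 ∧ (axis n y f ≠ 0 → (axis n y' f').rootMultiplicity (IsLocalRing.residue O z') ≤ (axis n y f).rootMultiplicity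 (IsLocalRing.residue O z)) ∧ IsSeparable (IntermediateField.adjoin k (Set.range fun i => (y' i : K))) (z' : K) ∧ ∀ (Ω : Type) [Field Ω] [Algebra K Ω] [IsAlgClosure K Ω] (V : ValuationSubring Ω), V.comap (algebraMap K Ω) = O → let F : Subfield Ω := (IntermediateField.adjoin k (Set.range fun i => (y' i : K))).toSubfield.map (algebraMap K Ω); let Fh : Subfield Ω := (IntermediateField.lift (IntermediateField.fixedField (ValuationSubring.decompositionSubgroup F (V.comap (algebraMap (separableClosure F Ω) Ω))))).toSubfield; let T : Subfield Ω := Fh ⊔ (algebraMap K Ω).fieldRange; Fh ≤ T ∧ 0 < Subfield.relfinrank Fh T ∧ Subfield.relfinrank Fh T = (Literature.AlgebraicGeometry.Resolution.valueSubgroup Fh V).relIndex (Literature.AlgebraicGeometry.Resolution.valueSubgroup T V) * (Literature.AlgebraicGeometry.Resolution.residueSubfield Fh V).relfinrank (Literature.AlgebraicGeometry.Resolution.residueSubfield T V)) : DefectlessFramesR := by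
  intro p hp k K _ _ _ _ _ hfg O hk hR hZ ρ axis n y z f hy hadj hker hf
  obtain ⟨y₁, z₁, f₁, h1, _, h3, h4, h5, h6, h7, h8, _⟩ :=
    stub_dfrTwist p hp k K hfg O hk hR hZ n y z f hy hadj hker hf
  have hf₁ : f₁ ≠ 0 := by
    rintro rfl
    exact h7 (MvPolynomial.eval₂_zero _ _)
  exact dfrStep_transfer k K O hk n y z f y₁ z₁ f₁ h5 h6 h7 h8
    (dfrStep_R hK p hp n _ k K hfg O hk hR hZ y₁ z₁ f₁ h1 h3 h4 hf₁ h7 rfl)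

/-- BC3 assembly: the crux BY NAME from the single registered stub `stub_dfrKernelStep` (the four landed stubs
`stub_dfrTwist`, `stub_dfrSmallAxis` (inside `stub_dfrFrameOfAxisDropAt`), `stub_dfrAbhyankar`, `stub_dfrDiscrete`
are imported theorems). -/
theorem DefectlessFramesR_of : DefectlessFramesR :=
  defectlessFramesR_of_kernelStep stub_dfrKernelStep

end Summit.ResolutionOfSingularities.ResolutionOfSingularities.Theorems
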